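import Summits.QuantumFields.YangMills.Theses.ConvexGribovBody
import Literature.MathematicalPhysics.QuantumLattice.ContinuumLimitLGT

/-!
# Route `ConvexGribovBody`, crux `NonSimplyConnectedLatticeGap` (stmt-QuantumFields-16405): vocabulary of the line `Sketch`
# (good exterior data: no long chain of bad plaquettes in the shell around a cube)

Route-posited objects (D-0016 `<Route><Crux>Defs` file) shared by the registered stubs of the skeleton
`Cruxes/NonSimplyConnectedLatticeGap/Lines/Sketch.lean` (v12, lead `prover-line-stmt-QuantumFields-16405-c5-0`) and by the
stub files that prove them. Nothing here is asserted; the registered stub MEAS `stub_measurableSet_goodExterior` (measurability of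
`goodExterior`) is proved at the end.

Background (`Cruxes/NonSimplyConnectedLatticeGap/ForcedMonopoleLines.md`): for gauge groups with `π₁(G) ≠ 0` exterior data
can force a conserved `π₁(G)`-monopole world-line through a cube `Λ_L = [−L,L]⁴ × univ`, so weak mixing cannot hold uniformly
over ALL exterior data; every monopole cube carries a plaquette `p` with `Re tr ρ(U_p) ≤ N − a₀(G, ρ)`, and a forced line
shows up as a long chain of such BAD plaquettes crossing the shell `L < ‖x‖∞ ≤ 2L` around the cube. The line's repaired
architecture is therefore: weak mixing uniformly over GOOD exterior data (no long bad chain in the shell) + rarity of bad data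
under the torus Wilson states (a Peierls bound at large `β`).

* `IsBadPlaquette ρ a U p` — the plaquette `p` of `ℤ⁴` is `a`-bad in `U`: `Re tr ρ(U_p) ≤ N − a`.
* `siteSupNorm x = ‖x‖∞` (as a natural number) for a site `x : ℤ⁴`.
* `shell L` — the plaquettes whose base point `x` has `L < ‖x‖∞ ≤ 2L` (the exterior shell of thickness `L` around `Λ_L`;
  it contains the layer `‖x‖∞ = L + 1` on which the kernel `γ_{Λ_L}(· | η)` actually reads `η`).
* `HasLongBadChain ρ a L U` — there is a chain `p₀, …, p_k` of `a`-bad plaquettes of `U` in `shell L`, consecutive base points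
  within `ℓ∞`-distance `2`, with end-to-end `ℓ∞`-distance `≥ L / 8` (natural division; for `L < 8` any single bad plaquette
  in the shell is a long chain).
* `goodExterior ρ a L` — the set of configurations WITHOUT a long bad chain around `Λ_L`.

References: G. Mack, V. B. Petkova, Ann. Phys. 123 (1979) 442 and E. T. Tomboulis, Phys. Rev. D 23 (1981) 2371 (ℤ₂ monopoles
and vortices of `SO(3)`/`SU(2)` lattice gauge theory); I. G. Halliday, A. Schwimmer, Phys. Lett. B 101 (1981) 327; P. de Forcrand,
O. Jahn, Nucl. Phys. B 651 (2003) 125 (`SO(3)` versus `SU(2)`: monopoles, twist sectors).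
-/

set_option autoImplicit false

noncomputable section

namespace Summit.QuantumFields.YangMills.Cruxes.NonSimplyConnectedLatticeGap.Sketch

open Literature.Probability.LatticeModels
open Literature.MathematicalPhysics.QuantumLattice

variable {G : Type} [Group G]

/-- The plaquette `p` of `ℤ⁴` is `a`-BAD in the configuration `U`: `Re tr ρ(U_p) ≤ N − a`
(tree `plaquetteObs ρ x i j U = Re tr ρ(U_{x;ij})`). -/
def IsBadPlaquette {N : ℕ} (ρ : G →* Matrix (Fin N) (Fin N) ℂ) (a : ℝ) (U : LGConfig 4 G) (p : ZdPlaquette 4) : Prop :=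
  plaquetteObs ρ p.1 p.2.1.1 p.2.1.2 U ≤ (N : ℝ) - a

/-- The sup-norm `‖x‖∞ = max_i |x_i|` of a site of `ℤ⁴`, as a natural number. -/
def siteSupNorm (x : Site 4) : ℕ := Finset.univ.sup fun i => (x i).natAbs

/-- The exterior shell of thickness `L` around the cube `Λ_L = [−L,L]⁴ × univ`: plaquettes whose base point has
`L < ‖x‖∞ ≤ 2L`. -/
def shell (L : ℕ) : Set (ZdPlaquette 4) := {p | L < siteSupNorm p.1 ∧ siteSupNorm p.1 ≤ 2 * L}

/-- `U` has a LONG BAD CHAIN around `Λ_L`: plaquettes `c 0, …, c k` in `shell L`, all `a`-bad, consecutive base points within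
`ℓ∞`-distance `2`, end-to-end `ℓ∞`-distance at least `L / 8`. -/
def HasLongBadChain {N : ℕ} (ρ : G →* Matrix (Fin N) (Fin N) ℂ) (a : ℝ) (L : ℕ) (U : LGConfig 4 G) : Prop :=
  ∃ (k : ℕ) (c : Fin (k + 1) → ZdPlaquette 4), (∀ i, c i ∈ shell L) ∧ (∀ i, IsBadPlaquette ρ a U (c i)) ∧
    (∀ i : Fin k, siteSupNorm ((c i.castSucc).1 - (c i.succ).1) ≤ 2) ∧
      L / 8 ≤ siteSupNorm ((c 0).1 - (c (Fin.last k)).1)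

/-- GOOD exterior data for the cube `Λ_L`: configurations without a long bad chain in `shell L`. -/
def goodExterior {N : ℕ} (ρ : G →* Matrix (Fin N) (Fin N) ℂ) (a : ℝ) (L : ℕ) : Set (LGConfig 4 G) :=
  {U | ¬ HasLongBadChain ρ a L U}

/-- Unfolding lemma for `goodExterior` (by `Iff.rfl`). -/
theorem mem_goodExterior_iff {N : ℕ} (ρ : G →* Matrix (Fin N) (Fin N) ℂ) (a : ℝ) (L : ℕ) (U : LGConfig 4 G) :
    U ∈ goodExterior ρ a L ↔ ¬ HasLongBadChain ρ a L U := Iff.rfl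

/-- A configuration all of whose shell plaquettes are good is good exterior data (no chain can even start). -/
theorem mem_goodExterior_of_forall_not_bad {N : ℕ} (ρ : G →* Matrix (Fin N) (Fin N) ℂ) (a : ℝ) (L : ℕ)
    (U : LGConfig 4 G) (h : ∀ p ∈ shell L, ¬ IsBadPlaquette ρ a U p) : U ∈ goodExterior ρ a L := by
  rintro ⟨k, c, hc, hbad, -, -⟩
  exact h (c 0) (hc 0) (hbad 0)

/-- **Registered stub MEAS — `goodExterior ρ a L` is measurable** (product σ-algebra), for a continuous representation
`ρ` of a second-countable topological group with its Borel σ-algebra: the complement of a countable union (over the length `k` and the chain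
`c : Fin (k+1) → ZdPlaquette 4`) of finite intersections of the closed half-spaces `{U | Re tr ρ(U_{c i}) ≤ N − a}` of the
continuous plaquette observables. -/
theorem stub_measurableSet_goodExterior : ∀ (G : Type) [Group G] [TopologicalSpace G] [IsTopologicalGroup G] [MeasurableSpace G] [BorelSpace G] [SecondCountableTopology G] (N : ℕ) (ρ : G →* Matrix (Fin N) (Fin N) ℂ), Continuous ρ → ∀ (a : ℝ) (L : ℕ), MeasurableSet (Summit.QuantumFields.YangMills.Cruxes.NonSimplyConnectedLatticeGap.Sketch.goodExterior ρ a L) := by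
  intro G _ _ _ _ _ _ N ρ hρ a L
  -- the bad event of one plaquette is a closed half-space of a continuous observable
  have hbad : ∀ p : ZdPlaquette 4, MeasurableSet {U : LGConfig 4 G | IsBadPlaquette ρ a U p} := fun p =>
    measurableSet_le (measurable_plaquetteObs ρ hρ p.1 p.2.1.1 p.2.1.2) measurable_const
  -- the long-bad-chain event is a countable union of finite intersections of such events
  have hchain : MeasurableSet {U : LGConfig 4 G | HasLongBadChain ρ a L U} := by
    have e : {U : LGConfig 4 G | HasLongBadChain ρ a L U} =
        ⋃ k : ℕ, ⋃ c : Fin (k + 1) → ZdPlaquette 4,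
          {U | (∀ i, c i ∈ shell L) ∧ (∀ i : Fin k, siteSupNorm ((c i.castSucc).1 - (c i.succ).1) ≤ 2) ∧
              L / 8 ≤ siteSupNorm ((c 0).1 - (c (Fin.last k)).1)} ∩ ⋂ i, {U | IsBadPlaquette ρ a U (c i)} := by
      ext U
      simp only [HasLongBadChain, Set.mem_setOf_eq, Set.mem_iUnion, Set.mem_inter_iff, Set.mem_iInter]
      constructor
      · rintro ⟨k, c, h1, h2, h3, h4⟩
        exact ⟨k, c, ⟨h1, h3, h4⟩, h2⟩
      · rintro ⟨k, c, ⟨h1, h3, h4⟩, h2⟩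
        exact ⟨k, c, h1, h2, h3, h4⟩
    rw [e]
    refine MeasurableSet.iUnion fun k => MeasurableSet.iUnion fun c => ?_
    refine MeasurableSet.inter ?_ (MeasurableSet.iInter fun i => hbad (c i))
    by_cases h : (∀ i, c i ∈ shell L) ∧ (∀ i : Fin k, siteSupNorm ((c i.castSucc).1 - (c i.succ).1) ≤ 2) ∧
        L / 8 ≤ siteSupNorm ((c 0).1 - (c (Fin.last k)).1)
    · have : {U : LGConfig 4 G | (∀ i, c i ∈ shell L) ∧
          (∀ i : Fin k, siteSupNorm ((c i.castSucc).1 - (c i.succ).1) ≤ 2) ∧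
            L / 8 ≤ siteSupNorm ((c 0).1 - (c (Fin.last k)).1)} = Set.univ :=
        Set.eq_univ_of_forall fun _ => h
      rw [this]
      exact MeasurableSet.univ
    · have : {U : LGConfig 4 G | (∀ i, c i ∈ shell L) ∧
          (∀ i : Fin k, siteSupNorm ((c i.castSucc).1 - (c i.succ).1) ≤ 2) ∧
            L / 8 ≤ siteSupNorm ((c 0).1 - (c (Fin.last k)).1)} = ∅ :=
        Set.eq_empty_of_forall_notMem fun _ hU => h hU
      rw [this]
      exact MeasurableSet.empty
  show MeasurableSet {U : LGConfig 4 G | ¬ HasLongBadChain ρ a L U}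
  exact hchain.compl

end Summit.QuantumFields.YangMills.Cruxes.NonSimplyConnectedLatticeGap.Sketch

end
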